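import Mathlib.LinearAlgebra.Matrix.Block
import Mathlib.LinearAlgebra.Matrix.NonsingularInverse
import Mathlib.Data.ZMod.Basic
import Mathlib.Algebra.BigOperators.Intervals
import Mathlib.Algebra.Order.BigOperators.Group.LocallyFinite
import HarnessLib

/-!
# Randomizing polynomials I: the Ishai–Kushilevitz matrix randomization over `F₂`

The linear algebra behind the PERFECT DEGREE-3 RANDOMIZED ENCODING of an iterated product
`f(x, ρ) = x₀ x₁ ⋯ x_d + ρ` over `F₂` [Ishai–Kushilevitz 2002, §3; Applebaum–Ishai–Kushilevitz 2006,
§4; used by Dvir–Gutfreund–Rothblum–Vadhan 2010, Thm 4.5 for the degree reduction `PEA_d ≤ PEA_3`].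
The product is the "determinant" of the `(d+1) × (d+1)` PATH MATRIX `L(x, ρ)` (`pathMat`: `xᵢ` on the
diagonal, `1` on the subdiagonal, `ρ` added in the top-right corner); the encoding outputs the entries
on and above the diagonal of `R₁ · L(x, ρ) · R₂` for a uniformly random upper unitriangular `R₁`
(`IsUnitri`) and a uniformly random `R₂ = 1 + (last column above the diagonal)` (`IsLastCol`).

This file (I of the series) fixes the OBJECTS over `ZMod 2` in dimension `d + 1 ≥ 1` — the two
randomizer families `IsUnitri` / `IsLastCol`, the path matrix `pathMat xs ρ`, its canonical form
`canon δ = pathMat 0 δ`, its value `pathVal xs ρ = ∏ xs + ρ`, and the explicit eliminators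
`elimA` (`A₀`), `elimAinv` (`A₀⁻¹ = 1 + superdiagonal`), `elimB` (`B₀`) — together with the entrywise
multiplication rules (`pathMat_mul_apply`, `mul_pathMat_apply`, `mul_lastCol_apply`,
`elimAinv_mul_apply`) and the closure / invertibility facts of the two families (`IsUnitri.mul`,
`IsLastCol.mul`, `IsUnitri.isUnit`, `IsLastCol.mul_self : B * B = 1`).  The canonical-form theorem
and the three properties of the randomization `(A, B) ↦ proj (A · L · B)` (injective, decodable,
range depends only on the value) are in `RandomizingPolynomialsCanon.lean`.

Not here: general branching programs (only the path program of an iterated product is needed for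
degree reduction), other fields, the polynomial / entropy level (files III–IV of the series).

## References

* Y. Ishai, E. Kushilevitz, *Perfect constant-round secure computation via perfect randomizing
  polynomials*, ICALP 2002, §3 (the matrix randomization `R₁ L R₂` and its canonical form).
* B. Applebaum, Y. Ishai, E. Kushilevitz, *Cryptography in NC⁰*, SIAM J. Comput. 36 (2006), §4.2.
* Z. Dvir, D. Gutfreund, G. N. Rothblum, S. Vadhan, *On approximating the entropy of polynomial
  mappings*, ICS 2011 / ECCC TR10-160, Thm 4.5 and Claim 4.4.
-/

namespace Literature.Computability.Complexity

namespace RandPoly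

open Matrix Finset

variable {d : ℕ}

/-- Square matrices of size `d + 1` over `F₂`. [folklore] -/
abbrev Mat (d : ℕ) : Type := Matrix (Fin (d + 1)) (Fin (d + 1)) (ZMod 2)

/-- Upper unitriangular matrices (`1` on the diagonal, `0` below): the randomizers `R₁`.
[cite: IshaiKushilevitz2002, §3] -/
def IsUnitri (A : Mat d) : Prop :=
  (∀ i, A i i = 1) ∧ ∀ i j : Fin (d + 1), j < i → A i j = 0

/-- Matrices `1 + N` with `N` supported in the last column strictly above the diagonal: the
randomizers `R₂`. [cite: IshaiKushilevitz2002, §3] -/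
def IsLastCol (B : Mat d) : Prop :=
  (∀ i, B i i = 1) ∧ ∀ i j : Fin (d + 1), i ≠ j → j ≠ Fin.last d → B i j = 0

/-- The path matrix `L(x, ρ)` of the branching program for `x₀ ⋯ x_d + ρ`: `xᵢ` on the diagonal, `1`
on the subdiagonal, `ρ` added at the top-right corner (for `d = 0` the single entry is `x₀ + ρ`).
[cite: IshaiKushilevitz2002, §3] -/
def pathMat (xs : Fin (d + 1) → ZMod 2) (ρ : ZMod 2) : Mat d :=
  Matrix.of fun i j =>
    (if i = j then xs i else 0) + (if i.val = j.val + 1 then 1 else 0) +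
      (if i = 0 ∧ j = Fin.last d then ρ else 0)

/-- The canonical form `C_δ`: `1` on the subdiagonal, `δ` in the top-right corner. [cite: IshaiKushilevitz2002, §3] -/
def canon (δ : ZMod 2) : Mat d := pathMat 0 δ

/-- The value computed by the path: `x₀ ⋯ x_d + ρ`. [cite: IshaiKushilevitz2002, §3] -/
def pathVal (xs : Fin (d + 1) → ZMod 2) (ρ : ZMod 2) : ZMod 2 := (∏ i, xs i) + ρ

/-- Coordinates extended by `0` beyond the range (for interval products). [folklore] -/
def ext (xs : Fin (d + 1) → ZMod 2) (l : ℕ) : ZMod 2 := if h : l < d + 1 then xs ⟨l, h⟩ else 0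

/-- The explicit row eliminator `A₀(x)`: entry `(i, j)`, `i ≤ j`, is `∏_{i ≤ l < j} x_l`.
[cite: IshaiKushilevitz2002, §3] -/
def elimA (xs : Fin (d + 1) → ZMod 2) : Mat d :=
  Matrix.of fun i j => if i ≤ j then ∏ l ∈ Ico i.val j.val, ext xs l else 0

/-- The inverse of `A₀(x)`: `1 + (xᵢ on the superdiagonal)`. [cite: IshaiKushilevitz2002, §3] -/
def elimAinv (xs : Fin (d + 1) → ZMod 2) : Mat d :=
  Matrix.of fun i j => if i = j then 1 else if j.val = i.val + 1 then xs i else 0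

/-- The explicit column eliminator `B₀(x)`: last column `∏_{i < l ≤ d} x_l`, identity elsewhere.
[cite: IshaiKushilevitz2002, §3] -/
def elimB (xs : Fin (d + 1) → ZMod 2) : Mat d :=
  Matrix.of fun i j => if j = Fin.last d then ∏ l ∈ Ico (i.val + 1) (d + 1), ext xs l
    else if i = j then 1 else 0

/-! ### Summation helpers over `Fin (d+1)` -/

/-- A sum with a diagonal selector. [folklore] -/
theorem sum_ite_eq_mul (i : Fin (d + 1)) (c : ZMod 2) (g : Fin (d + 1) → ZMod 2) :
    (∑ l, (if i = l then c else 0) * g l) = c * g i := by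
  simp [ite_mul]

/-- A sum with a subdiagonal selector on the left index. [folklore] -/
theorem sum_subdiag_mul (i : Fin (d + 1)) (g : Fin (d + 1) → ZMod 2) :
    (∑ l : Fin (d + 1), (if i.val = l.val + 1 then (1 : ZMod 2) else 0) * g l) =
      if h : 0 < i.val then g ⟨i.val - 1, by omega⟩ else 0 := by
  split_ifs with h
  · rw [Finset.sum_eq_single ⟨i.val - 1, by omega⟩]
    · rw [if_pos (by simp; omega), one_mul]
    · intro b _ hb
      have : i.val ≠ b.val + 1 := fun h' => hb (Fin.ext (by simp; omega))
      simp [this]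
    · simp
  · refine Finset.sum_eq_zero fun l _ => ?_
    have : i.val ≠ l.val + 1 := by omega
    simp [this]

/-- A sum with a subdiagonal selector on the right index. [folklore] -/
theorem sum_mul_subdiag (k : Fin (d + 1)) (g : Fin (d + 1) → ZMod 2) :
    (∑ j : Fin (d + 1), g j * (if j.val = k.val + 1 then (1 : ZMod 2) else 0)) =
      if h : k.val + 1 < d + 1 then g ⟨k.val + 1, h⟩ else 0 := by
  split_ifs with h
  · rw [Finset.sum_eq_single ⟨k.val + 1, h⟩]
    · simp
    · intro b _ hb
      have : b.val ≠ k.val + 1 := fun h' => hb (Fin.ext (by simp; omega))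
      simp [this]
    · simp
  · refine Finset.sum_eq_zero fun j _ => ?_
    have : j.val ≠ k.val + 1 := by omega
    simp [this]

/-- A sum with a corner selector. [folklore] -/
theorem sum_corner_mul (i : Fin (d + 1)) (ρ : ZMod 2) (g : Fin (d + 1) → ZMod 2) :
    (∑ l : Fin (d + 1), (if i = 0 ∧ l = Fin.last d then ρ else 0) * g l) =
      if i = 0 then ρ * g (Fin.last d) else 0 := by
  by_cases hi : i = 0
  · simp only [hi, true_and, if_true]
    rw [Finset.sum_eq_single (Fin.last d)]
    · simp
    · intro b _ hb; simp [hb]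
    · simp
  · simp [hi]

/-- A sum with a corner selector on the right. [folklore] -/
theorem sum_mul_corner (k : Fin (d + 1)) (ρ : ZMod 2) (g : Fin (d + 1) → ZMod 2) :
    (∑ j : Fin (d + 1), g j * (if j = 0 ∧ k = Fin.last d then ρ else 0)) =
      if k = Fin.last d then g 0 * ρ else 0 := by
  by_cases hk : k = Fin.last d
  · simp only [hk, and_true, if_true]
    rw [Finset.sum_eq_single 0]
    · simp
    · intro b _ hb; simp [hb]
    · simp
  · simp [hk]

/-- Left multiplication by a path matrix, entrywise. [folklore] -/
theorem pathMat_mul_apply (xs : Fin (d + 1) → ZMod 2) (ρ : ZMod 2) (M : Mat d) (i k : Fin (d + 1)) :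
    (pathMat xs ρ * M) i k =
      xs i * M i k + (if h : 0 < i.val then M ⟨i.val - 1, by omega⟩ k else 0) +
        (if i = 0 then ρ * M (Fin.last d) k else 0) := by
  simp only [pathMat, mul_apply, of_apply, add_mul, Finset.sum_add_distrib]
  rw [sum_ite_eq_mul, sum_subdiag_mul, sum_corner_mul]

/-- Right multiplication by a path matrix, entrywise. [folklore] -/
theorem mul_pathMat_apply (M : Mat d) (xs : Fin (d + 1) → ZMod 2) (ρ : ZMod 2) (i k : Fin (d + 1)) :
    (M * pathMat xs ρ) i k =
      M i k * xs k + (if h : k.val + 1 < d + 1 then M i ⟨k.val + 1, h⟩ else 0) +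
        (if k = Fin.last d then M i 0 * ρ else 0) := by
  simp only [pathMat, mul_apply, of_apply, mul_add, Finset.sum_add_distrib]
  rw [sum_mul_subdiag, sum_mul_corner]
  congr 1; congr 1
  rw [Finset.sum_eq_single k]
  · simp
  · intro b _ hb; simp [hb]
  · simp

/-- Right multiplication by a last-column matrix, entrywise. [folklore] -/
theorem mul_lastCol_apply {B : Mat d} (hB : IsLastCol B) (M : Mat d) (i k : Fin (d + 1)) :
    (M * B) i k = if k = Fin.last d then ∑ l, M i l * B l k else M i k := by
  split_ifs with hk
  · rfl
  · rw [mul_apply, Finset.sum_eq_single k]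
    · rw [hB.1 k, mul_one]
    · intro b _ hb; rw [hB.2 b k hb hk, mul_zero]
    · simp

/-- Left multiplication by the superdiagonal eliminator, entrywise. [folklore] -/
theorem elimAinv_mul_apply (xs : Fin (d + 1) → ZMod 2) (M : Mat d) (i k : Fin (d + 1)) :
    (elimAinv xs * M) i k = M i k + (if h : i.val + 1 < d + 1 then xs i * M ⟨i.val + 1, h⟩ k else 0) := by
  simp only [elimAinv, mul_apply, of_apply]
  have hsplit : ∀ j : Fin (d + 1),
      (if i = j then (1 : ZMod 2) else if j.val = i.val + 1 then xs i else 0) * M j k =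
        (if i = j then M j k else 0) + (if j.val = i.val + 1 then xs i * M j k else 0) := by
    intro j
    by_cases hij : i = j
    · subst hij; simp
    · simp only [hij, if_false, zero_add]
      split_ifs <;> simp
  simp only [hsplit, Finset.sum_add_distrib, Finset.sum_ite_eq, Finset.mem_univ, if_true]
  congr 1
  split_ifs with h
  · rw [Finset.sum_eq_single ⟨i.val + 1, h⟩]
    · simp
    · intro b _ hb
      have : b.val ≠ i.val + 1 := fun h' => hb (Fin.ext (by simp; omega))
      simp [this]
    · simp
  · refine Finset.sum_eq_zero fun j _ => ?_
    have : j.val ≠ i.val + 1 := by omega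
    simp [this]

/-! ### The two randomizer families -/

/-- Upper unitriangular matrices are closed under products. [folklore] -/
theorem IsUnitri.mul {A A' : Mat d} (hA : IsUnitri A) (hA' : IsUnitri A') : IsUnitri (A * A') := by
  refine ⟨fun i => ?_, fun i j hji => ?_⟩
  · rw [mul_apply, Finset.sum_eq_single i]
    · rw [hA.1, hA'.1, mul_one]
    · intro b _ hb
      rcases lt_or_gt_of_ne hb with h | h
      · rw [hA.2 i b h, zero_mul]
      · rw [hA'.2 b i h, mul_zero]
    · simp
  · rw [mul_apply]
    refine Finset.sum_eq_zero fun l _ => ?_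
    rcases lt_or_ge l i with h | h
    · rw [hA.2 i l h, zero_mul]
    · rw [hA'.2 l j (lt_of_lt_of_le hji h), mul_zero]

/-- Last-column matrices are closed under products. [folklore] -/
theorem IsLastCol.mul {B B' : Mat d} (hB : IsLastCol B) (hB' : IsLastCol B') : IsLastCol (B * B') := by
  refine ⟨fun i => ?_, fun i j hij hj => ?_⟩
  · rw [mul_lastCol_apply hB']
    split_ifs with hi
    · rw [Finset.sum_eq_single i]
      · rw [hB.1, hB'.1, mul_one]
      · intro b _ hb
        rw [hB.2 i b (Ne.symm hb) (fun h => hb (h.trans hi.symm)), zero_mul]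
      · simp
    · exact hB.1 i
  · rw [mul_lastCol_apply hB', if_neg hj, hB.2 i j hij hj]

/-- An upper unitriangular matrix is invertible (its determinant is `1`). [folklore] -/
theorem IsUnitri.isUnit {A : Mat d} (hA : IsUnitri A) : IsUnit A := by
  have hdet : A.det = 1 := by
    rw [Matrix.det_of_upperTriangular (fun i j hij => hA.2 i j hij)]
    exact Finset.prod_eq_one fun i _ => hA.1 i
  exact (Matrix.isUnit_iff_isUnit_det A).2 (by rw [hdet]; exact isUnit_one)

/-- The first column of an upper unitriangular matrix is `e₀`. [folklore] -/
theorem IsUnitri.apply_zero {A : Mat d} (hA : IsUnitri A) (i : Fin (d + 1)) :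
    A i 0 = if i = 0 then 1 else 0 := by
  split_ifs with hi
  · rw [hi, hA.1]
  · exact hA.2 i 0 ((Fin.pos_iff_ne_zero' i).2 hi)

/-- A last-column matrix is an involution over `F₂`: `B * B = 1`. [folklore] -/
theorem IsLastCol.mul_self {B : Mat d} (hB : IsLastCol B) : B * B = 1 := by
  ext i k
  rw [mul_lastCol_apply hB, Matrix.one_apply]
  by_cases hk : k = Fin.last d
  · rw [if_pos hk]
    subst hk
    by_cases hik : i = Fin.last d
    · rw [if_pos hik]
      subst hik
      rw [Finset.sum_eq_single (Fin.last d)]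
      · rw [hB.1, mul_one]
      · intro b _ hb
        rw [hB.2 _ b (Ne.symm hb) hb, zero_mul]
      · simp
    · rw [if_neg hik]
      rw [← Finset.add_sum_erase _ _ (Finset.mem_univ i), hB.1 i, one_mul,
        Finset.sum_eq_single (Fin.last d)]
      · rw [hB.1, mul_one, CharTwo.add_self_eq_zero]
      · intro b hb hbl
        rw [hB.2 i b (Ne.symm (Finset.ne_of_mem_erase hb)) hbl, zero_mul]
      · intro h
        exact absurd (Finset.mem_erase.2 ⟨Ne.symm hik, Finset.mem_univ _⟩) h
  · rw [if_neg hk]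
    by_cases hik : i = k
    · rw [if_pos hik]; subst hik; exact hB.1 i
    · rw [if_neg hik]; exact hB.2 i k hik hk

/-- `B₀(x)` is a last-column matrix. [folklore] -/
theorem elimB_isLastCol (xs : Fin (d + 1) → ZMod 2) : IsLastCol (elimB xs) := by
  refine ⟨fun i => ?_, fun i j hij hj => ?_⟩
  · simp only [elimB, of_apply]
    split_ifs with h
    · rw [h, Fin.val_last, Finset.Ico_self, Finset.prod_empty]
    · rfl
  · simp only [elimB, of_apply, if_neg hj, if_neg hij]

/-- `A₀(x)` is upper unitriangular. [folklore] -/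
theorem elimA_isUnitri (xs : Fin (d + 1) → ZMod 2) : IsUnitri (elimA xs) := by
  refine ⟨fun i => ?_, fun i j hji => ?_⟩
  · simp [elimA]
  · simp only [elimA, of_apply, if_neg (not_le.2 hji)]

/-- `A₀(x)⁻¹` is upper unitriangular. [folklore] -/
theorem elimAinv_isUnitri (xs : Fin (d + 1) → ZMod 2) : IsUnitri (elimAinv xs) := by
  refine ⟨fun i => ?_, fun i j hji => ?_⟩
  · simp [elimAinv]
  · have h1 : i ≠ j := fun h => by rw [h] at hji; exact lt_irrefl _ hji
    have h2 : j.val ≠ i.val + 1 := by have := Fin.lt_def.1 hji; omega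
    simp only [elimAinv, of_apply, if_neg h1, if_neg h2]

/-- A last-column matrix is upper unitriangular. [folklore] -/
theorem IsLastCol.isUnitri {B : Mat d} (hB : IsLastCol B) : IsUnitri B :=
  ⟨hB.1, fun i j hji => hB.2 i j (Ne.symm (ne_of_lt hji)) (fun h => by
    rw [h] at hji; exact absurd (Fin.le_last i) (not_le.2 hji))⟩

end RandPoly

end Literature.Computability.Complexity
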